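import Summits.QuantumAdvantage.AdviceFreeQNC0.PerOutputGatesFibre39
import HarnessLib

/-!
# Cell qa-qnc0, `p = 3` — (J2) `BlockFibre37.PerOutputGatesHardConst` is CHARGE-INDEPENDENT: the conjecture at the single charge `n + 2`
# (= the ring game on the odd class) implies it at every charge
# (prover qn-prover-3 g28; sequel of `PerOutputGatesFibre39`; companion of `PerOutputFormsFrame39` for (J3))

(J2) (`BlockCombJoin37`, planner qa-qnc0-p1 g37: «the meeting point of the two programmes») asks, for every charge `c`, that a strategy whose output
`g` is a table of its own `r` dense `𝔽₃`-forms AND of its walk window of radius `(log₂ n)^C` wins `ringWinU c` on `≤ θ·2ⁿ` inputs.  Any proof through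
the ring game / odd class reaches only the charge `n + 2` (`rel_iff_ringWinU`).  Here: that suffices.

* `card_gates_le_of_topCharge` — counting over the eight PREFIX fibres (`PerOutputGatesFibre39.gatesFibre_eq`: on `{glue3 a w b}` the strategy is a
  (J2)-strategy of the window game with `4r` forms, radius `R' ≥ R + 1`, charge `c + 3 + 2|a|`): hardness at the charges `≡ n + 2` for the window
  class bounds every charge on `n + 3` bits by `(6 + 2θ)·2ⁿ` (two of the eight prefixes are good: `two_le_card_charge_class` after `×2 mod 3`);
* ★★ **`perOutputGatesHardConst_of_topCharge`** — (J2) at the single charge `n + 2` (all `r, C`, all large `n`) ⟹ `PerOutputGatesHardConst`, with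
  `θ' = (3 + θ)/4` (radius bookkeeping `(log₂(n+3))^C + 1 ≤ (log₂ n)^{2C+1}`, `WalkCoreCharge.log_pow_add_three_le`).

WHAT THIS IS NOT: (J2) is not proved (OPEN); no x-frame form is typed for (J2) (walk windows are prefix parities of the letters, not juntas); crux
`stmt-QuantumAdvantage-22907` untouched; no ledger item (D-0168 shelf).
-/

noncomputable section

namespace Summit.QuantumAdvantage.AdviceFreeQNC0

open Classical
open Finset
open Literature.Computability.MetaComplexity

namespace BlockFibre37

variable {n : ℕ}

/-- Window-locality is monotone in the radius. -/
theorem windowLocal_mono {R R' : ℕ} (h : R ≤ R') {y : Fin (n + 1) → (Fin n → Bool) → Bool} (hy : WindowLocal R y) :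
    WindowLocal R' y :=
  fun g u v huv => hy g u v fun i h1 h2 => huv i (by omega) (by omega)

/-- **Counting over the eight prefix fibres.**  If every (J2)-strategy of the window game (`n` bits, `4r` forms per output, radius `R'`) wins
`≤ θ·2ⁿ` at the charges `≡ n + 2 (mod 3)`, then every (J2)-strategy (`r` forms, radius `R`, `R + 1 ≤ R'`) on `n + 3` bits wins at EVERY charge `c`
on at most `(6 + 2θ)·2ⁿ` inputs. -/
theorem card_gates_le_of_topCharge (hn : 1 ≤ n) (r : ℕ) {R R' : ℕ} (hRR : R + 1 ≤ R') {θ : ℝ} (hθ : θ ≤ 1)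
    (H : ∀ c₀ : ℕ, c₀ % 3 = (n + 2) % 3 →
      ∀ (ℓ' : Fin (n + 1) → Fin (Fintype.card (Fin r ⊕ (Fin 3 × Fin r))) → Fin (n + 1) → ZMod 3)
        (F' : Fin (n + 1) → (Fin (Fintype.card (Fin r ⊕ (Fin 3 × Fin r))) → ZMod 3) → (Fin n → Bool) → Bool),
        (∀ t, WindowLocal R' (fun g w => F' g t w)) →
        ((univ.filter fun w : Fin n → Bool =>
            ringWinU c₀ (fun g w => F' g (fun i => gateSum (ℓ' g i) w) w) w = true).card : ℝ) ≤ θ * (2 : ℝ) ^ n)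
    (ℓ : Fin (3 + n + 0 + 1) → Fin r → Fin (3 + n + 0 + 1) → ZMod 3)
    (F : Fin (3 + n + 0 + 1) → (Fin r → ZMod 3) → (Fin (3 + n + 0) → Bool) → Bool)
    (hloc : ∀ t, WindowLocal R (fun g u => F g t u)) (c : ℕ) :
    ((univ.filter fun u : Fin (3 + n + 0) → Bool =>
        ringWinU c (fun g u => F g (fun i => gateSum (ℓ g i) u) u) u = true).card : ℝ) ≤ (6 + 2 * θ) * (2 : ℝ) ^ n := by
  rw [card_filter_eq_sum_glue3 (fun u : Fin (3 + n + 0) → Bool =>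
    ringWinU c (fun g u => F g (fun i => gateSum (ℓ g i) u) u) u = true)]
  push_cast
  have hfib : ∀ (a : Fin 3 → Bool) (b : Fin 0 → Bool),
      ((univ.filter fun w : Fin n → Bool =>
          ringWinU c (fun g u => F g (fun i => gateSum (ℓ g i) u) u) (glue3 a w b) = true).card : ℝ) ≤
        (2 : ℝ) ^ n - (1 - θ) * (2 : ℝ) ^ n * (if (2 * c + wt a) % 3 = (2 * n + 4) % 3 then 1 else 0) := by
    intro a b
    obtain ⟨ℓ', F', hloc', hfibre⟩ := gatesFibre_eq hn r hRR ℓ F hloc c a b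
    have heq : (univ.filter fun w : Fin n → Bool =>
        ringWinU c (fun g u => F g (fun i => gateSum (ℓ g i) u) u) (glue3 a w b) = true) =
        univ.filter fun w : Fin n → Bool =>
          ringWinU (c + 3 + 2 * wt a) (fun g w => F' g (fun i => gateSum (ℓ' g i) w) w) w = true :=
      Finset.filter_congr fun w _ => by rw [hfibre w]
    rw [heq]
    have h1 := Finset.card_le_univ (univ.filter fun w : Fin n → Bool =>
      ringWinU (c + 3 + 2 * wt a) (fun g w => F' g (fun i => gateSum (ℓ' g i) w) w) w = true)
    rw [Fintype.card_fun, Fintype.card_bool, Fintype.card_fin] at h1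
    have h2 : ((univ.filter fun w : Fin n → Bool =>
        ringWinU (c + 3 + 2 * wt a) (fun g w => F' g (fun i => gateSum (ℓ' g i) w) w) w = true).card : ℝ)
          ≤ (2 : ℝ) ^ n := by
      exact_mod_cast h1
    split_ifs with ha
    · have hch : (c + 3 + 2 * wt a) % 3 = (n + 2) % 3 := by omega
      have h := H (c + 3 + 2 * wt a) hch ℓ' F' hloc'
      linarith
    · linarith
  have hgood := two_le_card_charge_class 3 (2 * c) (2 * n + 4) (le_refl 3)
  have h2n : (0 : ℝ) ≤ (2 : ℝ) ^ n := by positivity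
  calc ∑ a : Fin 3 → Bool, ∑ b : Fin 0 → Bool, ((univ.filter fun w : Fin n → Bool =>
          ringWinU c (fun g u => F g (fun i => gateSum (ℓ g i) u) u) (glue3 a w b) = true).card : ℝ)
      ≤ ∑ a : Fin 3 → Bool, ∑ _b : Fin 0 → Bool,
          ((2 : ℝ) ^ n - (1 - θ) * (2 : ℝ) ^ n * (if (2 * c + wt a) % 3 = (2 * n + 4) % 3 then 1 else 0)) :=
        Finset.sum_le_sum fun a _ => Finset.sum_le_sum fun b _ => hfib a b
    _ = ∑ a : Fin 3 → Bool,
          ((2 : ℝ) ^ n - (1 - θ) * (2 : ℝ) ^ n * (if (2 * c + wt a) % 3 = (2 * n + 4) % 3 then 1 else 0)) := by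
        refine Finset.sum_congr rfl fun a _ => ?_
        rw [Finset.sum_const, Finset.card_univ, Fintype.card_fun, Fintype.card_bool, Fintype.card_fin,
          pow_zero, one_smul]
    _ = (2 : ℝ) ^ n * (2 : ℝ) ^ 3 -
          (1 - θ) * (2 : ℝ) ^ n *
            ((univ.filter fun a : Fin 3 → Bool => (2 * c + wt a) % 3 = (2 * n + 4) % 3).card : ℝ) := by
        rw [Finset.sum_sub_distrib, Finset.sum_const, Finset.card_univ, Fintype.card_fun, Fintype.card_bool,
          Fintype.card_fin, ← Finset.mul_sum, Finset.sum_boole, nsmul_eq_mul]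
        push_cast
        ring
    _ ≤ (6 + 2 * θ) * (2 : ℝ) ^ n := by
        nlinarith [mul_nonneg (mul_nonneg (sub_nonneg.mpr hθ) h2n) (sub_nonneg.mpr hgood)]

/-- ★★ **(J2) at the single charge `n + 2` (all `r, C`, all large `n`) implies (J2) at EVERY charge**, with `θ' = (3 + θ)/4`: peel the first three
walk bits (`card_gates_le_of_topCharge`, hypothesis at `4r` forms and radius exponent `2C + 1`). -/
theorem perOutputGatesHardConst_of_topCharge
    (h : ∃ θ : ℝ, θ < 1 ∧ ∀ r C : ℕ, ∃ n₀ : ℕ, ∀ n ≥ n₀,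
      ∀ (ℓ : Fin (n + 1) → Fin r → Fin (n + 1) → ZMod 3)
        (F : Fin (n + 1) → (Fin r → ZMod 3) → (Fin n → Bool) → Bool),
        (∀ t, WindowLocal ((Nat.log 2 n) ^ C) (fun g u => F g t u)) →
        ((univ.filter fun u : Fin n → Bool =>
            ringWinU (n + 2) (fun g u => F g (fun i => gateSum (ℓ g i) u) u) u = true).card : ℝ) ≤ θ * (2 : ℝ) ^ n) :
    PerOutputGatesHardConst := by
  obtain ⟨θ, hθ, hall⟩ := h
  refine ⟨(3 + θ) / 4, by linarith, fun r C => ?_⟩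
  obtain ⟨n₀, hn₀⟩ := hall (Fintype.card (Fin r ⊕ (Fin 3 × Fin r))) (2 * C + 1)
  refine ⟨n₀ + 7, fun N hN ℓ c F hloc => ?_⟩
  obtain ⟨n, rfl⟩ : ∃ n, N = 3 + n + 0 := ⟨N - 3, by omega⟩
  have hn4 : 4 ≤ n := by omega
  have hnn : n₀ ≤ n := by omega
  have hRR : (Nat.log 2 (3 + n + 0)) ^ C + 1 ≤ (Nat.log 2 n) ^ (2 * C + 1) := by
    rw [show 3 + n + 0 = n + 3 by omega]; exact log_pow_add_three_le hn4 C
  have H : ∀ c₀ : ℕ, c₀ % 3 = (n + 2) % 3 →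
      ∀ (ℓ' : Fin (n + 1) → Fin (Fintype.card (Fin r ⊕ (Fin 3 × Fin r))) → Fin (n + 1) → ZMod 3)
        (F' : Fin (n + 1) → (Fin (Fintype.card (Fin r ⊕ (Fin 3 × Fin r))) → ZMod 3) → (Fin n → Bool) → Bool),
        (∀ t, WindowLocal ((Nat.log 2 n) ^ (2 * C + 1)) (fun g w => F' g t w)) →
        ((univ.filter fun w : Fin n → Bool =>
            ringWinU c₀ (fun g w => F' g (fun i => gateSum (ℓ' g i) w) w) w = true).card : ℝ) ≤ θ * (2 : ℝ) ^ n := by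
    intro c₀ hc₀ ℓ' F' hloc'
    have e : (univ.filter fun w : Fin n → Bool =>
        ringWinU c₀ (fun g w => F' g (fun i => gateSum (ℓ' g i) w) w) w = true) =
        univ.filter fun w : Fin n → Bool =>
          ringWinU (n + 2) (fun g w => F' g (fun i => gateSum (ℓ' g i) w) w) w = true :=
      Finset.filter_congr fun w _ => by rw [ringWinU_charge_mod hc₀]
    rw [e]
    exact hn₀ n hnn ℓ' F' hloc'
  have hmain := card_gates_le_of_topCharge (by omega) r hRR hθ.le H ℓ F hloc c
  have e2 : (2 : ℝ) ^ (3 + n + 0) = 8 * (2 : ℝ) ^ n := by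
    rw [show 3 + n + 0 = n + 3 by omega, pow_add]; norm_num; ring
  refine hmain.trans (le_of_eq ?_)
  rw [e2]
  ring

/-- **(J2) ⟺ (J2) at the single charge `n + 2`** (`perOutputGatesHardConst_of_topCharge` and the specialisation `c := n + 2`), recorded by name. -/
theorem perOutputGatesHardConst_iff_topCharge :
    PerOutputGatesHardConst ↔
      ∃ θ : ℝ, θ < 1 ∧ ∀ r C : ℕ, ∃ n₀ : ℕ, ∀ n ≥ n₀,
        ∀ (ℓ : Fin (n + 1) → Fin r → Fin (n + 1) → ZMod 3)
          (F : Fin (n + 1) → (Fin r → ZMod 3) → (Fin n → Bool) → Bool),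
          (∀ t, WindowLocal ((Nat.log 2 n) ^ C) (fun g u => F g t u)) →
          ((univ.filter fun u : Fin n → Bool =>
              ringWinU (n + 2) (fun g u => F g (fun i => gateSum (ℓ g i) u) u) u = true).card : ℝ) ≤ θ * (2 : ℝ) ^ n := by
  refine ⟨fun h => ?_, perOutputGatesHardConst_of_topCharge⟩
  obtain ⟨θ, hθ, hall⟩ := h
  refine ⟨θ, hθ, fun r C => ?_⟩
  obtain ⟨n₀, hn₀⟩ := hall r C
  exact ⟨n₀, fun n hn ℓ F hloc => hn₀ n hn ℓ (n + 2) F hloc⟩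

end BlockFibre37

end Summit.QuantumAdvantage.AdviceFreeQNC0

end
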